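import Literature.Analysis.FluidPDE.ConfinedHardSphereFlowShortTime
import HarnessLib

/-!
# The complement of the confined short-time good set is thin

Eighth layer of the proof of `ConfinedHardSphereFlow.nonempty_torus_balls` (existence of the
confined hard-sphere flow on the torus among fixed round scatterers; Cercignani–Illner–Pulvirenti
1994 Thm. 4.2.1, App. 4.A p. 111; iteration scheme of Gallagher–Saint-Raymond–Texier 2013,
proof of Prop. 4.1.1 and Lemma 4.1.2): the measure-theoretic half of the short-time analysis for
the sphere–scatterer events, complementing `HardSphereShortTime` / `HardSphereTorusMeasure`
(pairs):

* `wallClose N ctr ρ r q` — sphere `q.1` is `r`-close to the scatterer `q.2`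
  (`ρ ≤ ‖x - c‖ ≤ ρ + r`); its volume in a velocity ball is `O(r)` (`volume_wallClose_inter_le`,
  one annulus), two distinct such events or one together with a close pair cost `O(r²)`;
* `wallBad N ctr ρ r` — a sphere on a scatterer, or two close sphere–scatterer events, or a close
  sphere–scatterer event together with a close pair, or a grazing sphere–scatterer motion; under
  the separation `2(ρ + r) < dist(c_k, c_l)` of the scatterers a confined datum outside the
  confined short-time good set `cShortGood` is in `shortBad ∪ wallBad`
  (`mem_shortBad_union_wallBad_of_not_mem_cShortGood`), and
  `vol((D \ cShortGood) ∩ velBall V) ≤ C(N, |ι|, d, V) r²` (`volume_diff_cShortGood_inter_velBall_le`).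

## References

* I. Gallagher, L. Saint-Raymond, B. Texier, *From Newton to Boltzmann* (2013), Lemma 4.1.2.
* C. Cercignani, R. Illner, M. Pulvirenti, *The Mathematical Theory of Dilute Gases*, Springer
  (1994), §4.2, App. 4.A.
-/

open Set Filter Function MeasureTheory Metric
open scoped ENNReal Topology InnerProductSpace

namespace Literature.Analysis.FluidPDE

noncomputable section

/-! ## The triangle inequality of the minimal-image distance -/

namespace Torus

variable {d : Type*} [Fintype d]

/-- The minimal-image distance on the flat torus satisfies the triangle inequality. [folklore] -/
theorem euclidDist_triangle (x y z : UnitAddTorus d) : euclidDist x z ≤ euclidDist x y + euclidDist y z := by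
  unfold euclidDist
  have hproj : FunctionSpaces.Torus.proj (reprSym (x - y) + reprSym (y - z)) = x - z := by
    rw [FunctionSpaces.Torus.proj_add, proj_reprSym, proj_reprSym]; abel
  exact (norm_reprSym_le_of_proj_eq hproj).trans (norm_add_le _ _)

end Torus

section Kinetic

namespace ConfinedAlexander

variable {d : Type*} [Fintype d] {N : ℕ} {ι : Type*} {ctr : ι → UnitAddTorus d} {ρ : ℝ} {hρ : 0 < ρ} {ε r δ : ℝ}

/-! ## Close sphere–scatterer events -/

/-- The distance of a sphere to a centre is a measurable function of the configuration. [folklore] -/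
theorem measurable_norm_sepVec_point (i : Fin N) (c : UnitAddTorus d) :
    Measurable fun z : Config N d (UnitAddTorus d) => ‖(Torus.geometry d).sepVec (z i).1 c‖ :=
  (Torus.measurable_geometry_sepVec.comp ((measurable_pi_apply i).fst.prodMk measurable_const)).norm

/-- `wallClose` is measurable. [folklore] -/
theorem measurableSet_wallClose (ctr : ι → UnitAddTorus d) (ρ r : ℝ) (q : Fin N × ι) :
    MeasurableSet (wallClose N ctr ρ r q) :=
  (measurableSet_le measurable_const (measurable_norm_sepVec_point q.1 (ctr q.2))).inter
    (measurableSet_le (measurable_norm_sepVec_point q.1 (ctr q.2)) measurable_const)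

/-- `wallClose q` does not depend on the coordinates of the other spheres. [folklore] -/
theorem update_mem_wallClose {q : Fin N × ι} {z : Config N d (UnitAddTorus d)} {a : Fin N} (ha : a ≠ q.1)
    (y : UnitAddTorus d × EuclideanSpace ℝ d) (hz : z ∈ wallClose N ctr ρ r q) : update z a y ∈ wallClose N ctr ρ r q := by
  simp only [wallClose, mem_setOf_eq, update_of_ne (Ne.symm ha)] at hz ⊢
  exact hz

/-- **One thin annulus costs a factor `r`**: for a measurable event `S'` not involving sphere
`q.1`, `vol(wallClose q ∩ S' ∩ velBall V) ≤ (d r · vol B₁) · vol(S' ∩ velBall V)`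
(`0 < ρ`, `0 ≤ r`, `ρ + r < 1/2`). [cite: GST2013, Lemma 4.1.2] -/
theorem volume_wallClose_inter_le (hρ0 : 0 < ρ) (hr : 0 ≤ r) (h : ρ + r < 1 / 2) (q : Fin N × ι)
    {S' : Set (Config N d (UnitAddTorus d))} (hS' : MeasurableSet S')
    (hinv : ∀ z y, z ∈ S' → update z q.1 y ∈ S') (V : ℝ) :
    volume (wallClose N ctr ρ r q ∩ S' ∩ velBall N d (UnitAddTorus d) V) ≤
      ENNReal.ofReal (Fintype.card d * r) * volume (Metric.ball (0 : EuclideanSpace ℝ d) 1) *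
        volume (S' ∩ velBall N d (UnitAddTorus d) V) := by
  refine volume_inter_velBall_le_of_sections ((measurableSet_wallClose ctr ρ r q).inter hS') hS' q.1
    _ inter_subset_right hinv fun z _ => ?_
  have hsec : {y : UnitAddTorus d × EuclideanSpace ℝ d | update z q.1 y ∈ wallClose N ctr ρ r q ∩ S'} ⊆
      {x : UnitAddTorus d | ρ ≤ Torus.euclidDist x (ctr q.2) ∧ Torus.euclidDist x (ctr q.2) ≤ ρ + r} ×ˢ
        (univ : Set (EuclideanSpace ℝ d)) := by
    intro y hy
    have h1 := hy.1
    simp only [wallClose, mem_setOf_eq, update_self, Torus.norm_geometry_sepVec] at h1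
    exact ⟨h1, mem_univ _⟩
  calc oneParticleMeasure d V {y | update z q.1 y ∈ wallClose N ctr ρ r q ∩ S'}
      ≤ oneParticleMeasure d V ({x : UnitAddTorus d | ρ ≤ Torus.euclidDist x (ctr q.2) ∧
          Torus.euclidDist x (ctr q.2) ≤ ρ + r} ×ˢ (univ : Set (EuclideanSpace ℝ d))) := measure_mono hsec
    _ = volume {x : UnitAddTorus d | ρ ≤ Torus.euclidDist x (ctr q.2) ∧ Torus.euclidDist x (ctr q.2) ≤ ρ + r} *
          oneParticleMeasure d V univ := oneParticleMeasure_prod_univ V _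
    _ ≤ _ := by gcongr; exact Torus.volume_annulus_le hρ0 hr h (ctr q.2)

/-- **A close sphere–scatterer event is thin**: `vol(wallClose q ∩ velBall V) ≤ (d r vol B₁) vol(B̄_V)^N`. [cite: GST2013, Lemma 4.1.2] -/
theorem volume_wallClose_inter_velBall_le (hρ0 : 0 < ρ) (hr : 0 ≤ r) (h : ρ + r < 1 / 2) (q : Fin N × ι) (V : ℝ) :
    volume (wallClose N ctr ρ r q ∩ velBall N d (UnitAddTorus d) V) ≤
      ENNReal.ofReal (Fintype.card d * r) * volume (Metric.ball (0 : EuclideanSpace ℝ d) 1) *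
        volume (Metric.closedBall (0 : EuclideanSpace ℝ d) V) ^ N := by
  have h1 := volume_wallClose_inter_le (ctr := ctr) hρ0 hr h q MeasurableSet.univ (fun _ _ _ => mem_univ _) V
  rw [inter_univ, univ_inter, volume_velBall] at h1
  exact h1

/-- **Two distinct close sphere–scatterer events with different spheres cost `r²`.** [cite: GST2013, Lemma 4.1.2] -/
theorem volume_wallClose_inter_wallClose_le (hρ0 : 0 < ρ) (hr : 0 ≤ r) (h : ρ + r < 1 / 2) {q q' : Fin N × ι}
    (hne : q.1 ≠ q'.1) (V : ℝ) :
    volume (wallClose N ctr ρ r q ∩ wallClose N ctr ρ r q' ∩ velBall N d (UnitAddTorus d) V) ≤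
      (ENNReal.ofReal (Fintype.card d * r) * volume (Metric.ball (0 : EuclideanSpace ℝ d) 1)) ^ 2 *
        volume (Metric.closedBall (0 : EuclideanSpace ℝ d) V) ^ N := by
  calc volume (wallClose N ctr ρ r q ∩ wallClose N ctr ρ r q' ∩ velBall N d (UnitAddTorus d) V)
      ≤ ENNReal.ofReal (Fintype.card d * r) * volume (Metric.ball (0 : EuclideanSpace ℝ d) 1) *
          volume (wallClose N ctr ρ r q' ∩ velBall N d (UnitAddTorus d) V) :=
        volume_wallClose_inter_le hρ0 hr h q (measurableSet_wallClose ctr ρ r q')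
          (fun z y hz => update_mem_wallClose hne y hz) V
    _ ≤ ENNReal.ofReal (Fintype.card d * r) * volume (Metric.ball (0 : EuclideanSpace ℝ d) 1) *
          (ENNReal.ofReal (Fintype.card d * r) * volume (Metric.ball (0 : EuclideanSpace ℝ d) 1) *
            volume (Metric.closedBall (0 : EuclideanSpace ℝ d) V) ^ N) := by
        gcongr; exact volume_wallClose_inter_velBall_le hρ0 hr h q' V
    _ = _ := by ring

/-- **A close sphere–scatterer event together with a close pair costs `r²`** (the pair has a
sphere other than the wall-close one, over whose position one integrates first). [cite: GST2013, Lemma 4.1.2] -/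
theorem volume_wallClose_inter_closePair_le (hε : 0 < ε) (hρ0 : 0 < ρ) (hr : 0 ≤ r) (hεr : ε + r < 1 / 2)
    (hρr : ρ + r < 1 / 2) (q : Fin N × ι) {k l : Fin N} (hkl : k ≠ l) (V : ℝ) :
    volume (wallClose N ctr ρ r q ∩ closePair N d ε r k l ∩ velBall N d (UnitAddTorus d) V) ≤
      (ENNReal.ofReal (Fintype.card d * r) * volume (Metric.ball (0 : EuclideanSpace ℝ d) 1)) ^ 2 *
        volume (Metric.closedBall (0 : EuclideanSpace ℝ d) V) ^ N := by
  -- a vertex of the pair that is not the wall-close sphere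
  obtain ⟨a, b, hab, ha, hset⟩ : ∃ a b : Fin N, a ≠ b ∧ a ≠ q.1 ∧ closePair N d ε r k l = closePair N d ε r a b := by
    by_cases hk : k = q.1
    · exact ⟨l, k, hkl.symm, fun h => hkl (hk.trans h.symm), closePair_comm ε r k l⟩
    · exact ⟨k, l, hkl, hk, rfl⟩
  rw [hset]
  calc volume (wallClose N ctr ρ r q ∩ closePair N d ε r a b ∩ velBall N d (UnitAddTorus d) V)
      = volume (closePair N d ε r a b ∩ wallClose N ctr ρ r q ∩ velBall N d (UnitAddTorus d) V) := by rw [inter_comm (wallClose N ctr ρ r q)]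
    _ ≤ ENNReal.ofReal (Fintype.card d * r) * volume (Metric.ball (0 : EuclideanSpace ℝ d) 1) *
          volume (wallClose N ctr ρ r q ∩ velBall N d (UnitAddTorus d) V) :=
        volume_closePair_inter_le hε hr hεr hab (measurableSet_wallClose ctr ρ r q)
          (fun z y hz => update_mem_wallClose ha y hz) V
    _ ≤ ENNReal.ofReal (Fintype.card d * r) * volume (Metric.ball (0 : EuclideanSpace ℝ d) 1) *
          (ENNReal.ofReal (Fintype.card d * r) * volume (Metric.ball (0 : EuclideanSpace ℝ d) 1) *
            volume (Metric.closedBall (0 : EuclideanSpace ℝ d) V) ^ N) := by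
        gcongr; exact volume_wallClose_inter_velBall_le hρ0 hr hρr q V
    _ = _ := by ring

/-- **Two close events of the same sphere with two separated scatterers are incompatible**:
if `2(ρ + r) < dist(c_k, c_l)` then `wallClose (i, k) ∩ wallClose (i, l) = ∅`. [folklore] -/
theorem wallClose_inter_wallClose_eq_empty {i : Fin N} {k l : ι}
    (hsep : 2 * (ρ + r) < Torus.euclidDist (ctr k) (ctr l)) :
    wallClose N ctr ρ r (i, k) ∩ wallClose N ctr ρ r (i, l) = ∅ := by
  ext z
  simp only [wallClose, mem_inter_iff, mem_setOf_eq, mem_empty_iff_false, iff_false, not_and, and_imp,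
    Torus.norm_geometry_sepVec]
  intro _ h1 _ h2
  have htri := Torus.euclidDist_triangle (ctr k) (z i).1 (ctr l)
  have e1 : Torus.euclidDist (ctr k) (z i).1 = Torus.euclidDist (z i).1 (ctr k) := Torus.euclidDist_comm _ _
  linarith

/-! ## Null sphere–scatterer events: contact and grazing -/

/-- **Sphere-on-scatterer configurations are null**: `vol {z | ‖x_i - c‖_{T^d} = ρ} = 0` for `ρ ≠ 0`. [folklore] -/
theorem volume_setOf_norm_sepVec_point_eq (hρ0 : ρ ≠ 0) (i : Fin N) (c : UnitAddTorus d) :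
    volume {z : Config N d (UnitAddTorus d) | ‖(Torus.geometry d).sepVec (z i).1 c‖ = ρ} = 0 := by
  have hmeas : MeasurableSet {z : Config N d (UnitAddTorus d) | ‖(Torus.geometry d).sepVec (z i).1 c‖ = ρ} :=
    measurableSet_eq_fun (measurable_norm_sepVec_point i c) measurable_const
  refine volume_eq_zero_of_sections hmeas i fun z => ?_
  have hsec : {y : UnitAddTorus d × EuclideanSpace ℝ d | update z i y ∈
      {z : Config N d (UnitAddTorus d) | ‖(Torus.geometry d).sepVec (z i).1 c‖ = ρ}} =
      {x : UnitAddTorus d | Torus.euclidDist x c = ρ} ×ˢ (univ : Set (EuclideanSpace ℝ d)) := by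
    ext y
    simp only [mem_setOf_eq, update_self, Torus.norm_geometry_sepVec, mem_prod, mem_univ, and_true]
  rw [hsec, Measure.volume_eq_prod, Measure.prod_prod, Torus.volume_euclidDist_eq hρ0, zero_mul]

/-- **Grazing sphere–scatterer motions are null**: for `ρ ≠ 0`, the configurations whose sphere
`i` has nonzero velocity and whose free motion relative to the centre `c` has vanishing
discriminant form a null set. [cite: GST2013, §4.1 p. 19] -/
theorem volume_setOf_pairDisc_sepVec_point_eq_zero (hρ0 : ρ ≠ 0) (i : Fin N) (c : UnitAddTorus d) :
    volume {z : Config N d (UnitAddTorus d) |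
      pairDisc ρ ((Torus.geometry d).sepVec (z i).1 c) (z i).2 = 0 ∧ (z i).2 ≠ 0} = 0 := by
  have hdisc : Measurable fun p : EuclideanSpace ℝ d × EuclideanSpace ℝ d => pairDisc ρ p.1 p.2 := by
    have : Continuous fun p : EuclideanSpace ℝ d × EuclideanSpace ℝ d => pairDisc ρ p.1 p.2 := by
      unfold pairDisc; fun_prop
    exact this.measurable
  have hmeas : MeasurableSet {z : Config N d (UnitAddTorus d) |
      pairDisc ρ ((Torus.geometry d).sepVec (z i).1 c) (z i).2 = 0 ∧ (z i).2 ≠ 0} := by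
    have hm1 : Measurable fun z : Config N d (UnitAddTorus d) => (Torus.geometry d).sepVec (z i).1 c :=
      Torus.measurable_geometry_sepVec.comp ((measurable_pi_apply i).fst.prodMk measurable_const)
    have hm2 : Measurable fun z : Config N d (UnitAddTorus d) => (z i).2 := (measurable_pi_apply i).snd
    exact (measurableSet_eq_fun (hdisc.comp (hm1.prodMk hm2)) measurable_const).inter
      (measurableSet_eq_fun hm2 measurable_const).compl
  refine volume_eq_zero_of_sections hmeas i fun z => ?_
  have hT' : {y : UnitAddTorus d × EuclideanSpace ℝ d | update z i y ∈
      {z : Config N d (UnitAddTorus d) | pairDisc ρ ((Torus.geometry d).sepVec (z i).1 c) (z i).2 = 0 ∧ (z i).2 ≠ 0}} =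
      {y : UnitAddTorus d × EuclideanSpace ℝ d | pairDisc ρ (Torus.reprSym (y.1 - c)) y.2 = 0 ∧ y.2 ≠ 0} := by
    ext y
    simp only [mem_setOf_eq, update_self, Torus.geometry_sepVec]
  have hTm : MeasurableSet {y : UnitAddTorus d × EuclideanSpace ℝ d | pairDisc ρ (Torus.reprSym (y.1 - c)) y.2 = 0 ∧ y.2 ≠ 0} :=
    (measurableSet_eq_fun (hdisc.comp ((Torus.measurable_reprSym.comp (measurable_fst.sub_const _)).prodMk
      measurable_snd)) measurable_const).inter (measurableSet_eq_fun measurable_snd measurable_const).compl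
  rw [hT', Measure.volume_eq_prod, Measure.prod_apply_symm hTm]
  refine (lintegral_congr fun v => ?_).trans lintegral_zero
  change volume ((fun x : UnitAddTorus d => (x, v)) ⁻¹' _) = 0
  by_cases hv : v = 0
  · have : (fun x : UnitAddTorus d => (x, v)) ⁻¹' {y : UnitAddTorus d × EuclideanSpace ℝ d |
        pairDisc ρ (Torus.reprSym (y.1 - c)) y.2 = 0 ∧ y.2 ≠ 0} = ∅ := by
      ext x
      simp only [mem_preimage, mem_setOf_eq, hv, ne_eq, not_true_eq_false, and_false, mem_empty_iff_false]
    rw [this, measure_empty]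
  · have hset : (fun x : UnitAddTorus d => (x, v)) ⁻¹' {y : UnitAddTorus d × EuclideanSpace ℝ d |
        pairDisc ρ (Torus.reprSym (y.1 - c)) y.2 = 0 ∧ y.2 ≠ 0} =
        {x : UnitAddTorus d | Torus.reprSym (x - c) ∈ {n : EuclideanSpace ℝ d | pairDisc ρ n v = 0}} := by
      ext x
      simp only [mem_preimage, mem_setOf_eq, ne_eq, hv, not_false_eq_true, and_true]
    have hZ : MeasurableSet {n : EuclideanSpace ℝ d | pairDisc ρ n v = 0} := by
      have hc : Continuous fun n : EuclideanSpace ℝ d => pairDisc ρ n v := by unfold pairDisc; fun_prop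
      exact measurableSet_eq_fun hc.measurable measurable_const
    rw [hset]
    exact (Torus.volume_reprSym_sub_mem (d := d) c hZ).trans (measure_mono_null inter_subset_left (volume_setOf_pairDisc_eq_zero hρ0 hv))

/-! ## The wall-bad set -/

/-- **A confined configuration outside the confined short-time good set is short-time bad or
wall-bad.** [cite: GST2013, proof of Prop. 4.1.1 p. 19] -/
theorem mem_shortBad_union_wallBad_of_not_mem_cShortGood {z : Config N d (UnitAddTorus d)}
    (hz : z ∈ confinedDomain (Torus.geometry d) (Wall.balls (Torus.geometry d) ctr ρ hρ) N ε)
    (hns : z ∉ cShortGood N ctr ε ρ r δ) : z ∈ Alexander.shortBad N ε r ∪ wallBad N ctr ε ρ r := by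
  by_contra hbad
  simp only [mem_union, not_or] at hbad
  obtain ⟨hsb, hwb⟩ := hbad
  simp only [wallBad, mem_union, mem_iUnion, mem_setOf_eq, mem_inter_iff, not_or, not_exists, not_and] at hwb
  obtain ⟨⟨⟨h1, h2⟩, h3⟩, h4⟩ := hwb
  apply hns
  have hsg : z ∈ Alexander.shortGood N ε r δ := by
    by_contra hsg
    exact hsb (Alexander.mem_shortBad_of_not_mem_shortGood hz.1 hsg)
  by_cases hfar : z ∈ wallFar N ctr ρ r
  · exact mem_cShortGood.2 (Or.inl ⟨hsg, hfar⟩)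
  simp only [wallFar, mem_setOf_eq, not_forall, not_lt] at hfar
  obtain ⟨i, k, hclose⟩ := hfar
  have hqc : z ∈ wallClose N ctr ρ r (i, k) := ⟨hz.2 i k, hclose⟩
  -- no second close sphere–scatterer event
  have ho : WallOthersFar ctr ρ r z (i, k) := by
    intro q' hq'
    by_contra hle
    rw [not_lt] at hle
    exact h2 ((i, k), q') (Ne.symm hq') hqc ⟨hz.2 q'.1 q'.2, hle⟩
  -- all pairs far
  have hfs : z ∈ Alexander.farSet N ε r := by
    intro a b hab
    by_contra hle
    rw [not_lt] at hle
    exact h3 ((i, k), (a, b)) hab hqc ⟨hz.1 a b hab, hle⟩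
  -- no contact at time `0`
  have hqρ : ρ < ‖(Torus.geometry d).sepVec (z i).1 (ctr k)‖ := lt_of_le_of_ne (hz.2 i k) fun heq => h1 (i, k) heq.symm
  refine mem_cShortGood.2 (Or.inr ⟨(i, k), ?_⟩)
  by_cases hP : PairHits ρ ((Torus.geometry d).sepVec (z i).1 (ctr k)) (z i).2
  · by_cases hτ : δ < pairHitTime ρ ((Torus.geometry d).sepVec (z i).1 (ctr k)) (z i).2
    · exact Or.inl ⟨hfs, ho, hqρ, hclose, Or.inr hτ⟩
    · rw [not_lt] at hτ
      by_cases hdisc : 0 < pairDisc ρ ((Torus.geometry d).sepVec (z i).1 (ctr k)) (z i).2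
      · exact Or.inr ⟨hfs, ho, hclose, ⟨hqρ, hP.1, hdisc⟩, hτ⟩
      · exfalso
        have hv : (z i).2 = 0 := by
          by_contra hv
          exact h4 (i, k) (le_antisymm (not_lt.1 hdisc) hP.2) hv
        have := hP.norm_pos
        rw [hv, norm_zero] at this
        exact lt_irrefl _ this
  · exact Or.inl ⟨hfs, ho, hqρ, hclose, Or.inl hP⟩

/-- **The wall-bad set is thin**: in the velocity ball of radius `V`, for separated scatterers,
`vol(wallBad) ≤ (N|ι|)² (d r vol B₁)² vol(B̄_V)^N + N|ι| N² (d r vol B₁)² vol(B̄_V)^N`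
(contact and grazing are null; two thin events cost `r²`). [cite: GST2013, Lemma 4.1.2] -/
theorem volume_wallBad_inter_velBall_le [Fintype ι] (hε : 0 < ε) (hρ0 : 0 < ρ) (hr : 0 ≤ r) (hεr : ε + r < 1 / 2)
    (hρr : ρ + r < 1 / 2) (hsep : ∀ k l : ι, k ≠ l → 2 * (ρ + r) < Torus.euclidDist (ctr k) (ctr l)) (V : ℝ) :
    volume (wallBad N ctr ε ρ r ∩ velBall N d (UnitAddTorus d) V) ≤
      ((Fintype.card ((Fin N × ι) × (Fin N × ι)) : ℝ≥0∞) + (Fintype.card ((Fin N × ι) × (Fin N × Fin N)) : ℝ≥0∞)) *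
        ((ENNReal.ofReal (Fintype.card d * r) * volume (Metric.ball (0 : EuclideanSpace ℝ d) 1)) ^ 2 *
          volume (Metric.closedBall (0 : EuclideanSpace ℝ d) V) ^ N) := by
  classical
  set B := (ENNReal.ofReal (Fintype.card d * r) * volume (Metric.ball (0 : EuclideanSpace ℝ d) 1)) ^ 2 *
    volume (Metric.closedBall (0 : EuclideanSpace ℝ d) V) ^ N with hB
  -- null parts
  have h1 : volume (⋃ q : Fin N × ι, {z : Config N d (UnitAddTorus d) | ‖(Torus.geometry d).sepVec (z q.1).1 (ctr q.2)‖ = ρ}) = 0 :=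
    measure_iUnion_null fun q => volume_setOf_norm_sepVec_point_eq hρ0.ne' q.1 (ctr q.2)
  have h4 : volume (⋃ q : Fin N × ι, {z : Config N d (UnitAddTorus d) |
      pairDisc ρ ((Torus.geometry d).sepVec (z q.1).1 (ctr q.2)) (z q.1).2 = 0 ∧ (z q.1).2 ≠ 0}) = 0 :=
    measure_iUnion_null fun q => volume_setOf_pairDisc_sepVec_point_eq_zero hρ0.ne' q.1 (ctr q.2)
  -- two wall-close events
  have h2 : volume ((⋃ qq : (Fin N × ι) × (Fin N × ι), {z : Config N d (UnitAddTorus d) |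
      qq.1 ≠ qq.2 ∧ z ∈ wallClose N ctr ρ r qq.1 ∩ wallClose N ctr ρ r qq.2}) ∩ velBall N d (UnitAddTorus d) V) ≤
      (Fintype.card ((Fin N × ι) × (Fin N × ι)) : ℝ≥0∞) * B := by
    rw [iUnion_inter]
    refine (measure_iUnion_fintype_le _ _).trans ?_
    have hle : ∀ qq : (Fin N × ι) × (Fin N × ι), volume ({z : Config N d (UnitAddTorus d) |
        qq.1 ≠ qq.2 ∧ z ∈ wallClose N ctr ρ r qq.1 ∩ wallClose N ctr ρ r qq.2} ∩ velBall N d (UnitAddTorus d) V) ≤ B := by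
      rintro ⟨q, q'⟩
      by_cases hqq : q = q'
      · have : {z : Config N d (UnitAddTorus d) | (q, q').1 ≠ (q, q').2 ∧
            z ∈ wallClose N ctr ρ r (q, q').1 ∩ wallClose N ctr ρ r (q, q').2} = ∅ := by
          ext z; simp [hqq]
        rw [this, empty_inter, measure_empty]; exact bot_le
      · have hset : {z : Config N d (UnitAddTorus d) | (q, q').1 ≠ (q, q').2 ∧
            z ∈ wallClose N ctr ρ r (q, q').1 ∩ wallClose N ctr ρ r (q, q').2} =
            wallClose N ctr ρ r q ∩ wallClose N ctr ρ r q' := by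
          ext z; simp only [mem_setOf_eq, mem_inter_iff, ne_eq, hqq, not_false_eq_true, true_and]
        rw [hset]
        by_cases hi : q.1 = q'.1
        · have hk : q.2 ≠ q'.2 := fun hk => hqq (Prod.ext hi hk)
          have hemp : wallClose N ctr ρ r q ∩ wallClose N ctr ρ r q' = ∅ := by
            have := wallClose_inter_wallClose_eq_empty (N := N) (i := q.1) (hsep q.2 q'.2 hk)
            rwa [show ((q.1, q'.2) : Fin N × ι) = q' from Prod.ext hi rfl] at this
          rw [hemp, empty_inter, measure_empty]; exact bot_le
        · exact volume_wallClose_inter_wallClose_le hρ0 hr hρr hi V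
    calc ∑ qq : (Fin N × ι) × (Fin N × ι), volume ({z : Config N d (UnitAddTorus d) |
          qq.1 ≠ qq.2 ∧ z ∈ wallClose N ctr ρ r qq.1 ∩ wallClose N ctr ρ r qq.2} ∩ velBall N d (UnitAddTorus d) V)
        ≤ ∑ _qq : (Fin N × ι) × (Fin N × ι), B := Finset.sum_le_sum fun qq _ => hle qq
      _ = (Fintype.card ((Fin N × ι) × (Fin N × ι)) : ℝ≥0∞) * B := by
          rw [Finset.sum_const, Finset.card_univ, nsmul_eq_mul]
  -- a wall-close event and a close pair
  have h3 : volume ((⋃ qp : (Fin N × ι) × (Fin N × Fin N), {z : Config N d (UnitAddTorus d) |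
      qp.2.1 ≠ qp.2.2 ∧ z ∈ wallClose N ctr ρ r qp.1 ∩ closePair N d ε r qp.2.1 qp.2.2}) ∩ velBall N d (UnitAddTorus d) V) ≤
      (Fintype.card ((Fin N × ι) × (Fin N × Fin N)) : ℝ≥0∞) * B := by
    rw [iUnion_inter]
    refine (measure_iUnion_fintype_le _ _).trans ?_
    have hle : ∀ qp : (Fin N × ι) × (Fin N × Fin N), volume ({z : Config N d (UnitAddTorus d) |
        qp.2.1 ≠ qp.2.2 ∧ z ∈ wallClose N ctr ρ r qp.1 ∩ closePair N d ε r qp.2.1 qp.2.2} ∩ velBall N d (UnitAddTorus d) V) ≤ B := by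
      rintro ⟨q, k, l⟩
      by_cases hkl : k = l
      · have : {z : Config N d (UnitAddTorus d) | (q, k, l).2.1 ≠ (q, k, l).2.2 ∧
            z ∈ wallClose N ctr ρ r (q, k, l).1 ∩ closePair N d ε r (q, k, l).2.1 (q, k, l).2.2} = ∅ := by
          ext z; simp [hkl]
        rw [this, empty_inter, measure_empty]; exact bot_le
      · have hset : {z : Config N d (UnitAddTorus d) | (q, k, l).2.1 ≠ (q, k, l).2.2 ∧
            z ∈ wallClose N ctr ρ r (q, k, l).1 ∩ closePair N d ε r (q, k, l).2.1 (q, k, l).2.2} =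
            wallClose N ctr ρ r q ∩ closePair N d ε r k l := by
          ext z; simp only [mem_setOf_eq, mem_inter_iff, ne_eq, hkl, not_false_eq_true, true_and]
        rw [hset]
        exact volume_wallClose_inter_closePair_le hε hρ0 hr hεr hρr q hkl V
    calc ∑ qp : (Fin N × ι) × (Fin N × Fin N), volume ({z : Config N d (UnitAddTorus d) |
          qp.2.1 ≠ qp.2.2 ∧ z ∈ wallClose N ctr ρ r qp.1 ∩ closePair N d ε r qp.2.1 qp.2.2} ∩ velBall N d (UnitAddTorus d) V)
        ≤ ∑ _qp : (Fin N × ι) × (Fin N × Fin N), B := Finset.sum_le_sum fun qp _ => hle qp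
      _ = (Fintype.card ((Fin N × ι) × (Fin N × Fin N)) : ℝ≥0∞) * B := by
          rw [Finset.sum_const, Finset.card_univ, nsmul_eq_mul]
  -- assemble
  rw [wallBad, union_inter_distrib_right, union_inter_distrib_right, union_inter_distrib_right]
  refine (measure_union_le _ _).trans ?_
  refine (add_le_add ((measure_union_le _ _).trans (add_le_add (measure_union_le _ _) le_rfl)) le_rfl).trans ?_
  have h1' : volume ((⋃ q : Fin N × ι, {z : Config N d (UnitAddTorus d) | ‖(Torus.geometry d).sepVec (z q.1).1 (ctr q.2)‖ = ρ}) ∩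
      velBall N d (UnitAddTorus d) V) = 0 := measure_mono_null inter_subset_left h1
  have h4' : volume ((⋃ q : Fin N × ι, {z : Config N d (UnitAddTorus d) |
      pairDisc ρ ((Torus.geometry d).sepVec (z q.1).1 (ctr q.2)) (z q.1).2 = 0 ∧ (z q.1).2 ≠ 0}) ∩ velBall N d (UnitAddTorus d) V) = 0 :=
    measure_mono_null inter_subset_left h4
  rw [h1', h4', zero_add, add_zero, add_mul]
  exact add_le_add h2 h3

/-- **The complement of the confined short-time good set in the confined domain is thin**:
`vol((D \ cShortGood) ∩ velBall V) ≤ (N⁴ + (N|ι|)² + N|ι|N²) (d r vol B₁)² vol(B̄_V)^N`. [cite: GST2013, Lemma 4.1.2] -/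
theorem volume_diff_cShortGood_inter_velBall_le [Fintype ι] (hε : 0 < ε) (hρ0 : 0 < ρ) (hr : 0 ≤ r)
    (hεr : ε + r < 1 / 2) (hρr : ρ + r < 1 / 2) (hsep : ∀ k l : ι, k ≠ l → 2 * (ρ + r) < Torus.euclidDist (ctr k) (ctr l))
    (δ V : ℝ) :
    volume ((confinedDomain (Torus.geometry d) (Wall.balls (Torus.geometry d) ctr ρ hρ) N ε \ cShortGood N ctr ε ρ r δ) ∩
        velBall N d (UnitAddTorus d) V) ≤
      ((N : ℝ≥0∞) ^ 4 + ((Fintype.card ((Fin N × ι) × (Fin N × ι)) : ℝ≥0∞) +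
          (Fintype.card ((Fin N × ι) × (Fin N × Fin N)) : ℝ≥0∞))) *
        ((ENNReal.ofReal (Fintype.card d * r) * volume (Metric.ball (0 : EuclideanSpace ℝ d) 1)) ^ 2 *
          volume (Metric.closedBall (0 : EuclideanSpace ℝ d) V) ^ N) := by
  have hcov : (confinedDomain (Torus.geometry d) (Wall.balls (Torus.geometry d) ctr ρ hρ) N ε \ cShortGood N ctr ε ρ r δ) ∩
      velBall N d (UnitAddTorus d) V ⊆ (Alexander.shortBad N ε r ∩ velBall N d (UnitAddTorus d) V) ∪
        (wallBad N ctr ε ρ r ∩ velBall N d (UnitAddTorus d) V) := by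
    rintro z ⟨⟨hz, hns⟩, hv⟩
    rcases mem_shortBad_union_wallBad_of_not_mem_cShortGood hz hns with h | h
    · exact Or.inl ⟨h, hv⟩
    · exact Or.inr ⟨h, hv⟩
  refine (measure_mono hcov).trans ((measure_union_le _ _).trans ?_)
  rw [add_mul]
  exact add_le_add (Alexander.volume_shortBad_inter_velBall_le hε hr hεr V) (volume_wallBad_inter_velBall_le hε hρ0 hr hεr hρr hsep V)

end ConfinedAlexander

end Kinetic

end

end Literature.Analysis.FluidPDE
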